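import Summits.QuantumFields.YangMills.Theorems.BalabanUVNodesN11Sect3SupplyChain
import Literature.MathematicalPhysics.QuantumFieldTheory.Balaban1983to89.Node00.Record13SepCoPHChi
import Literature.MathematicalPhysics.QuantumFieldTheory.Balaban1983to89.Node00.Record13ResidualsRChi
import Summits.QuantumFields.YangMills.Theorems.BalabanUVNodesN11HistoryPinnedResidualDefsChi
import Summits.QuantumFields.YangMills.Theorems.BalabanUVNodesN11RePinnedParamDefsChi
import Summits.QuantumFields.YangMills.Theorems.BalabanUVNodesN11NoExpansionAtRecord13CoPChi
import Summits.QuantumFields.YangMills.Theorems.BalabanUVNodesN11NoExpansionDiagonalCoPHChi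
import Summits.QuantumFields.YangMills.Theorems.BalabanUVNodesN11BackgroundScaleLocalChi
import Summits.QuantumFields.YangMills.Theorems.BalabanUVNodesN11Sect3SupplyPresentParentsChi
import Summits.QuantumFields.YangMills.Theorems.BalabanUVNodesN11NoExpansionOldFactorsChi
import Summits.QuantumFields.YangMills.Theorems.BalabanUVNodesN11NoExpansionGeneralStepCoPHOldBranchChi
import Summits.QuantumFields.YangMills.Theorems.BalabanUVNodesN11NoExpansionGeneralStepLawsCoPHChi
import Summits.QuantumFields.YangMills.Theorems.BalabanUVNodesN11NoExpansionGeneralStepGraphChi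
import Summits.QuantumFields.YangMills.Theorems.BalabanUVNodesN11DiagonalOldBranchMeasurableChi
import Summits.QuantumFields.YangMills.Theorems.BalabanUVNodesN11OldBranchPairChi
import Summits.QuantumFields.YangMills.Theorems.BalabanUVNodesN11TruncationDominationChi
import Summits.QuantumFields.YangMills.Theorems.BalabanUVNodesN11Sect3SupplySplicePairChi
import Summits.QuantumFields.YangMills.Theorems.BalabanUVNodesN11Sect3SupplyChainDefsChi
import Literature.MathematicalPhysics.QuantumFieldTheory.Balaban1983to89.B16RLeafRecord13LiveChi
import Literature.MathematicalPhysics.QuantumFieldTheory.Balaban1983to89.B16RLeafRecord13LiveGenericZSChi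

/-!
# χ-GENERIC RE-ISSUE (WORK ORDER RC-1 «RE-CENTRE THE RECORD», director-ym №462 (B) ∕ №467 (D)) of `BalabanUVNodesN11Sect3SupplyChain`

Cell `pub-ymgap` (HUMAN RULING D-0062, Track A), seat `pub-ymgap-dag-n11-d` (N11 [B14] s2; N11-σ campaign, `N11-G44-RC1-REACH-CENSUS.md`).  The CENTRE-TYPED
declarations of `BalabanUVNodesN11Sect3SupplyChain` (those whose statement reads the (2.9) cut-off centre through `gOfRecord₁₃ ∕ EOfRecord₁₃ ∕ Provisos₁₃… ∕ T∕SLaw₁₃… ∕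
UbgOfRecord₁₃… ∕ WtOfRecord₁₃… ∕ datum∕tower∕coreOfRecord₁₃…`) RE-ISSUED VERBATIM in the β-slot `χ : ChiSlot F N` over [Ax-3b]∕[Ax-3c]∕[Ax-3d]'s χ-generic carriers
(`Node00/Record13Chi` ∕ `Record13CoPHChi` ∕ `Record13SepCoPHChi`): σ = (binder `(χ : ChiSlot F N)` after `θ`; Node00 defs `X ↦ XChi … χ`; Node00 rows `Y ↦ Y_chi`;
this lane's sibling modules `…Chi` for Summits-side dependencies); SAME short names in the sibling namespace `…BalabanUVNodesN11Sect3SupplyChainChi` (consumers switch by namespace);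
the 2 centre-FREE declarations of the original are NOT copied — they are reused BY NAME (`open … (…)` below).  At `χ := chiβOfRecord₁₃ θ` every statement here is
DEFINITIONALLY the landed one ([Ax-3b]'s `rfl` receipts); at `χ := chiβOfRecord₁₃Ax θ` it is what the Ax-record's N11 machine reads.  Nothing of record edited (body-freeze №460 (2)).

HONEST FRAMING.  Count-neutral kernel re-elaboration of landed N11 bookkeeping∕estimates in a parameter; every HYPOTHESIS of the original stays a hypothesis; nothing of
Bałaban asserted beyond what the original file proves; N11 NOT discharged; K-items untouched; counts unmoved.  One finite `𝕋⁴_{L^K}` programme at fixed `ε = L^{−K}` —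
NOT ℝ⁴, NOT OS, NOT a mass gap, NOT Clay.  No `sorry`∕`instance`∕`notation`.  Sources: as the original module, plus [I] = [Balaban1987RG1] (2.9) p.266 (the cut-off's centre).
-/

noncomputable section

open MeasureTheory
open scoped BigOperators Matrix.Norms.L2Operator

namespace Summit.QuantumFields.YangMills.Theorems.BalabanUVNodesN11Sect3SupplyChainChi

open Summit.QuantumFields.YangMills.Theorems.BalabanUVNodesN11Sect3SupplyChain (newEClauses_of_newEClauses_of_eqE sLaw₁₃CoPH_all_of_chain)
open Literature.MathematicalPhysics.QuantumFieldTheory.Balaban1983to89 T4Continuum Node00 Node00.Tk DagBinding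
open Step B14.Eq227LocalizedTerms
open Literature.MathematicalPhysics.QuantumFieldTheory.Balaban1983to89.B16RLeafRecord13LiveGenericZSChi (slotClauseΦ_succ_of_slotTClauseΦ_of_liveSel_of_rstep)
open BalabanUVNodesN11Sect3SupplySpliceDefs
open BalabanUVNodesN11Sect3SupplySpliceFrame
open BalabanUVNodesN11Sect3SupplySpliceChi (lawsT_child_absent_of_newEClauses)
open BalabanUVNodesN11Sect3SupplySpliceOwnBoundary (graftAboveB graftAboveB_E)
open BalabanUVNodesN11Sect3SupplySpliceOwnBoundaryChi (lawsT_child_graftAboveB_of_rows)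
open BalabanUVNodesN11Sect3SupplyChainDefs hiding NewEClausesAt NoExpansionClauseFor PresentChildObligations Sect3Supplier baseWitness baseWitness_form chainWitness isFluctLocal_baseWitness isFluctLocal_chainWitness isFluctLocal_spliceTermsB spliceConst spliceConst_of_Omega_empty spliceConst_of_Omega_ne spliceTermsB spliceTermsB_E spliceTermsB_of_Omega_empty spliceTermsB_of_absent spliceTermsB_of_present universalE_spliceTermsB
open BalabanUVNodesN11Sect3SupplyChainDefsChi
open BalabanUVNodesN11NoExpansionTruncatedWitness (sect2Slot_succ_congr_of_agree_of_Omega_empty)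
open BalabanUVNodesN11NoExpansionGeneralStepLawsCoPHChi (sect2TowerOfRecord_rzAt_succ_eq_init_of_Omega_empty)
open BalabanUVNodesN11NoExpansionStepReductionCoPH (lawsT_towerOfTerms_of_lawsRT_of_agree_of_newE)
open BalabanUVNodesN11NoExpansionStepReductionRePinnedUnivECoPH (towerOfTerms_space_eq_of_bgI_eq)

/-! ## §0  Generic: the four level-`(k+1)` 𝐄-clauses transfer along equal `𝐄^{(k+1)}` and equal `bgI` -/

variable {F : T4Family} {N : ℕ} [NeZero N]
variable (θ : Stage13HParams F N) (χ : ChiSlot F N) (p : B12.RunParams)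

/-! ## §1  The witness-level 𝐑-step on the live-selector line -/

section RStep

/-- **★ THE WITNESS-LEVEL 𝐑-STEP ON THE LIVE-SELECTOR LINE**: a 𝐓-image witness `(tT, EkT)` of `𝐓ρ_k` at level `k` (laws `Sect2.LawsT … k` and the 𝐓-image clause at every
history of length `k+1`) IS a §2 witness of `ρ_{k+1}` — the SAME term values and constants: the laws weaken to the inductive assumptions at `k+1` (11c's `LawsT.toRT_succ`,
signs `0 ≤ β, κ, E₀, B₀`, `0 ≤ g_{k+1}`), and 𝐑 of record (row `rstep` of `θ.Provisos₁₃CoPH`, K0a's live selector) moves only DEAD sequences and is the identity on live ones, so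
the post-𝐑 slot is the pre-𝐑 slot a.e. on the χ-support or zero (this seat's clause-level `…LiveGenericZS.slotClauseΦ_succ_of_slotTClauseΦ_of_liveSel_of_rstep`).
[cite: Balaban1988Convergent, §2 p.262, Thm 2 p.263, (3.24)–(3.25) p.270; Balaban1989LargeFieldI, (0.2)–(0.4) p.176, p.177 (i)–(ii)] -/
theorem formAtZS_succ_of_formT_of_liveSel_of_rstep (h : θ.Provisos₁₃CoPHChi F N χ)
    (hsel : θ.ppSel = ppSelLiveOfRecord F N θ.ν θ.τ9 (EOfRecord₁₃Chi F N θ.toStage13Params χ) (wOfRecord₉ F N θ.toStage9Params))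
    (hθ : θ.Admissible F N) (hκ : 0 ≤ θ.s2.lf.κ) (hE₀ : 0 ≤ θ.s2.lf.E₀) (hB₀ : 0 ≤ θ.s2.lf.B₀) {k : ℕ} (hk : k < p.K)
    (tT : SeqOfRecord F θ.ν θ.τ9.M (gOfRecord₁₃Chi F N θ.toStage13Params χ p) p.K (k + 1) → Sect2.TermValues (F.P p.K) (MatA N) (FluctV N) θ.τ9.M) (EkT : SeqOfRecord F θ.ν θ.τ9.M (gOfRecord₁₃Chi F N θ.toStage13Params χ p) p.K (k + 1) → ℝ)
    (hT : HasSect2FormAtZS F N (FluctV N) p.K (settingOfRecord₁₃Chi F N θ.toStage13Params χ p) (k + 1) (θ.rzAtChi χ p) (WtOfRecord₁₃HChi F N θ χ p) (UbgOfRecord₁₃CoPChi F N θ.toStage13Params χ p (k + 1))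
      (fun s u => Sect2.LawsT (sect2TowerOfRecord F N (FluctV N) p.K (settingOfRecord₁₃Chi F N θ.toStage13Params χ p) (θ.rzAtChi χ p s) s u) (settingOfRecord₁₃Chi F N θ.toStage13Params χ p).lf (settingOfRecord₁₃Chi F N θ.toStage13Params χ p).βc k)
      (slotsTOfRecord F N θ.ν θ.τ9 (EOfRecord₁₃Chi F N θ.toStage13Params χ) (wOfRecord₉ F N θ.toStage9Params) θ.ppSel p (gOfRecord₁₃Chi F N θ.toStage13Params χ p) (k + 1)) tT EkT) :
    HasSect2FormAtZS F N (FluctV N) p.K (settingOfRecord₁₃Chi F N θ.toStage13Params χ p) (k + 1) (θ.rzAtChi χ p) (WtOfRecord₁₃HChi F N θ χ p) (UbgOfRecord₁₃CoPChi F N θ.toStage13Params χ p (k + 1))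
      (fun s u => Sect2.LawsRT (sect2TowerOfRecord F N (FluctV N) p.K (settingOfRecord₁₃Chi F N θ.toStage13Params χ p) (θ.rzAtChi χ p s) s u) (settingOfRecord₁₃Chi F N θ.toStage13Params χ p).lf (k + 1))
      (slotsOfRecord F N θ.ν θ.τ9 (EOfRecord₁₃Chi F N θ.toStage13Params χ) (wOfRecord₉ F N θ.toStage9Params) θ.ppSel p (gOfRecord₁₃Chi F N θ.toStage13Params χ p) (k + 1)) tT EkT := by
  obtain ⟨hu, hs⟩ := hT
  refine ⟨hu, fun s => ⟨(hs s).1.toRT_succ hθ.toStage12.pos.2.1 hκ hE₀ hB₀ (B16RLeafRecord13LiveChi.gOfRecord₁₃_succ_nonneg F N θ.toStage13Params χ p k), ?_⟩⟩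
  exact slotClauseΦ_succ_of_slotTClauseΦ_of_liveSel_of_rstep F N θ.toStage13Params χ p (fun q j _ hj => h.rstep q j hj) hsel k hk s _ (fun _ => (hs s).2)

end RStep

/-! ## §2  The witness-level 𝐓-step: the deterministic splice is a 𝐓-image witness -/

section TStep

/-- **★★ THE DETERMINISTIC SPLICE IS A 𝐓-IMAGE WITNESS AT LEVEL `k`** (generic `θ`; `1 ≤ M`, `0 ≤ B₀`): from a §2 witness `(t, E_k)` of `ρ_k` and the supplier's response
`(tnew, EkN)` (universal in 𝐄) with (OE) the four 𝐄-clauses for `tnew s′` at every `s′`, the obligations `PresentChildObligations` at every 𝐓-present expansion child, and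
dag-n11-d's `NoExpansionClauseFor (t, E_k)`, the pair `(spliceTermsB θ χ p k t tnew, spliceConst θ χ p k E_k EkN)` has the laws `Sect2.LawsT … k` and the 𝐓-image clause at EVERY
history of length `k+1`: no-expansion histories by p550088 ∕ p552803 ∕ p549689 (the child's frame is the parent's; laws with the universal new 𝐄 and no new `𝐑 ∕ 𝐁`; the
clause does not read the witness above `k`), 𝐓-absent expansion children by `…Splice.lawsT_child_absent_of_newEClauses` and the zero disjunct, 𝐓-present ones by
`…OwnBoundary.lawsT_child_graftAboveB_of_rows` and (O3′). [cite: Balaban1988Convergent, Theorem p.245, §2 p.262, §3 p.279, (3.24)–(3.25) p.270, (3.1) p.264, (2.25)–(2.31) pp.259–260, (2.40)–(2.42) p.261] -/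
theorem formT_spliceTermsB_of_rows {k : ℕ} (hM : 1 ≤ θ.τ9.M) (hB₀ : 0 ≤ θ.s2.lf.B₀)
    (t : SeqOfRecord F θ.ν θ.τ9.M (gOfRecord₁₃Chi F N θ.toStage13Params χ p) p.K k → Sect2.TermValues (F.P p.K) (MatA N) (FluctV N) θ.τ9.M) (Ek : SeqOfRecord F θ.ν θ.τ9.M (gOfRecord₁₃Chi F N θ.toStage13Params χ p) p.K k → ℝ)
    (hS : HasSect2FormAtZS F N (FluctV N) p.K (settingOfRecord₁₃Chi F N θ.toStage13Params χ p) k (θ.rzAtChi χ p) (WtOfRecord₁₃HChi F N θ χ p) (UbgOfRecord₁₃CoPChi F N θ.toStage13Params χ p k)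
      (fun s u => Sect2.LawsRT (sect2TowerOfRecord F N (FluctV N) p.K (settingOfRecord₁₃Chi F N θ.toStage13Params χ p) (θ.rzAtChi χ p s) s u) (settingOfRecord₁₃Chi F N θ.toStage13Params χ p).lf k)
      (slotsOfRecord F N θ.ν θ.τ9 (EOfRecord₁₃Chi F N θ.toStage13Params χ) (wOfRecord₉ F N θ.toStage9Params) θ.ppSel p (gOfRecord₁₃Chi F N θ.toStage13Params χ p) k) t Ek)
    (tnew : SeqOfRecord F θ.ν θ.τ9.M (gOfRecord₁₃Chi F N θ.toStage13Params χ p) p.K (k + 1) → Sect2.TermValues (F.P p.K) (MatA N) (FluctV N) θ.τ9.M) (EkN : SeqOfRecord F θ.ν θ.τ9.M (gOfRecord₁₃Chi F N θ.toStage13Params χ p) p.K (k + 1) → ℝ) (huN : Sect2.UniversalE tnew)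
    (hOE : ∀ s : SeqOfRecord F θ.ν θ.τ9.M (gOfRecord₁₃Chi F N θ.toStage13Params χ p) p.K (k + 1), NewEClausesAt θ χ p k (tnew s) s)
    (hpres : ∀ s : SeqOfRecord F θ.ν θ.τ9.M (gOfRecord₁₃Chi F N θ.toStage13Params χ p) p.K (k + 1), s.Ω (k + 1) ≠ ∅ → slotsTOfRecord F N θ.ν θ.τ9 (EOfRecord₁₃Chi F N θ.toStage13Params χ) (wOfRecord₉ F N θ.toStage9Params) θ.ppSel p (gOfRecord₁₃Chi F N θ.toStage13Params χ p) (k + 1) s ≠ 0 → PresentChildObligations θ χ p k t tnew EkN s)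
    (hTcl : NoExpansionClauseFor θ χ p k t Ek) :
    HasSect2FormAtZS F N (FluctV N) p.K (settingOfRecord₁₃Chi F N θ.toStage13Params χ p) (k + 1) (θ.rzAtChi χ p) (WtOfRecord₁₃HChi F N θ χ p) (UbgOfRecord₁₃CoPChi F N θ.toStage13Params χ p (k + 1))
      (fun s u => Sect2.LawsT (sect2TowerOfRecord F N (FluctV N) p.K (settingOfRecord₁₃Chi F N θ.toStage13Params χ p) (θ.rzAtChi χ p s) s u) (settingOfRecord₁₃Chi F N θ.toStage13Params χ p).lf (settingOfRecord₁₃Chi F N θ.toStage13Params χ p).βc k)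
      (slotsTOfRecord F N θ.ν θ.τ9 (EOfRecord₁₃Chi F N θ.toStage13Params χ) (wOfRecord₉ F N θ.toStage9Params) θ.ppSel p (gOfRecord₁₃Chi F N θ.toStage13Params χ p) (k + 1)) (spliceTermsB θ χ p k t tnew) (spliceConst θ χ p k Ek EkN) := by
  classical
  obtain ⟨hu, hs⟩ := hS
  have hrg := settingOfRecord₁₃_satisfiesRG_chi F N θ.toStage13Params χ p (k + 1) k (Nat.lt_succ_self k)
  have hg := B16RLeafRecord13LiveChi.gOfRecord₁₃_succ_nonneg F N θ.toStage13Params χ p k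
  -- the four 𝐄-clauses for any term values whose `𝐄^{(k+1)}` is `(tnew s)`'s, on the child's tower
  have hEcl : ∀ (s : SeqOfRecord F θ.ν θ.τ9.M (gOfRecord₁₃Chi F N θ.toStage13Params χ p) p.K (k + 1)) (t' : Sect2.TermValues (F.P p.K) (MatA N) (FluctV N) θ.τ9.M), (∀ X z g, t'.E (k + 1) X z g = (tnew s).E (k + 1) X z g) →
      (∀ X z g φ ψ, (sect2TowerOfRecord F N (FluctV N) p.K (settingOfRecord₁₃Chi F N θ.toStage13Params χ p) (θ.rzAtChi χ p s) s t').agreeOn (k + 1) X φ ψ → t'.E (k + 1) X z g φ = t'.E (k + 1) X z g ψ) ∧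
      (∀ X z g v φ, t'.E (k + 1) X z g ((sect2TowerOfRecord F N (FluctV N) p.K (settingOfRecord₁₃Chi F N θ.toStage13Params χ p) (θ.rzAtChi χ p s) s t').act v φ) = t'.E (k + 1) X z g φ) ∧
      (∀ X z g φ, 0 ≤ g → g ≤ (settingOfRecord₁₃Chi F N θ.toStage13Params χ p).lf.γ →
        φ ∈ (sect2TowerOfRecord F N (FluctV N) p.K (settingOfRecord₁₃Chi F N θ.toStage13Params χ p) (θ.rzAtChi χ p s) s t').space (k + 1) X ((settingOfRecord₁₃Chi F N θ.toStage13Params χ p).lf.alpha0 ((settingOfRecord₁₃Chi F N θ.toStage13Params χ p).flow.g (k + 1))) ((settingOfRecord₁₃Chi F N θ.toStage13Params χ p).lf.alpha1 ((settingOfRecord₁₃Chi F N θ.toStage13Params χ p).flow.g (k + 1))) →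
          ‖t'.E (k + 1) X z g φ‖ ≤ (settingOfRecord₁₃Chi F N θ.toStage13Params χ p).lf.E₀ * Real.exp (-((1 + 4 * (settingOfRecord₁₃Chi F N θ.toStage13Params χ p).βc) * (settingOfRecord₁₃Chi F N θ.toStage13Params χ p).lf.κ) * (Sect2.domSys (F.P p.K) θ.τ9.M (k + 1)).dj X)) ∧
      (∀ X z g, 0 ≤ g → g ≤ (settingOfRecord₁₃Chi F N θ.toStage13Params χ p).lf.γ →
        AnalyticOnNhd ℂ (t'.E (k + 1) X z g)
          ((sect2TowerOfRecord F N (FluctV N) p.K (settingOfRecord₁₃Chi F N θ.toStage13Params χ p) (θ.rzAtChi χ p s) s t').space (k + 1) X ((settingOfRecord₁₃Chi F N θ.toStage13Params χ p).lf.alpha0 ((settingOfRecord₁₃Chi F N θ.toStage13Params χ p).flow.g (k + 1))) ((settingOfRecord₁₃Chi F N θ.toStage13Params χ p).lf.alpha1 ((settingOfRecord₁₃Chi F N θ.toStage13Params χ p).flow.g (k + 1))))) :=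
    fun s t' hE' => newEClauses_of_newEClauses_of_eqE (settingOfRecord₁₃Chi F N θ.toStage13Params χ p) (Rz := θ.rzAtChi χ p s) (Rz' := θ.rzAtChi χ p s) rfl s.Ω s.Ω hE' (hOE s)
  refine ⟨universalE_spliceTermsB hu huN, fun s => ?_⟩
  by_cases hΩ : s.Ω (k + 1) = ∅
  · -- no-expansion history: old terms, universal new 𝐄, no new 𝐑 ∕ 𝐁, constant `E_k(init s′)`; the child's frame IS the parent's
    rw [spliceTermsB_of_Omega_empty t tnew s hΩ, spliceConst_of_Omega_empty Ek EkN s hΩ]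
    have hlaw : Sect2.LawsRT (sect2TowerOfRecord F N (FluctV N) p.K (settingOfRecord₁₃Chi F N θ.toStage13Params χ p) (θ.rzAtChi χ p s) s (t s.init)) (settingOfRecord₁₃Chi F N θ.toStage13Params χ p).lf k := by
      rw [sect2TowerOfRecord_rzAt_succ_eq_init_of_Omega_empty θ χ p s hΩ (t s.init)]; exact (hs s.init).1
    have hE : ∀ j, j ≤ k → ∀ X z g φ, (graftAbove k (t s.init) (zeroRB (tnew s))).E j X z g φ = (t s.init).E j X z g φ :=
      fun j hj X z g φ => graftAbove_E_of_le _ _ hj X z g φ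
    have hR : ∀ j, j ≤ k → ∀ X φ, (graftAbove k (t s.init) (zeroRB (tnew s))).R j X φ = (t s.init).R j X φ :=
      fun j hj X φ => graftAbove_R_of_le _ _ hj X φ
    have hB : ∀ j, j ≤ k → ∀ X φ a, (graftAbove k (t s.init) (zeroRB (tnew s))).B j X φ a = (t s.init).B j X φ a :=
      fun j hj X φ a => graftAbove_B_of_le _ _ hj X φ a
    obtain ⟨hloc, hinv, hbd, han⟩ := hEcl s (graftAbove k (t s.init) (zeroRB (tnew s))) (fun X z g => graftAbove_E_succ k _ _ X z g)
    refine ⟨lawsT_towerOfTerms_of_lawsRT_of_agree_of_newE _ _ _ hE hR hB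
      (fun X φ => by rw [graftAbove_R_of_lt _ _ (Nat.lt_succ_self k)]; rfl) (fun X φ a => by rw [graftAbove_B_of_lt _ _ (Nat.lt_succ_self k)]; rfl)
      hloc hinv hbd han hlaw hrg hB₀ hg, ?_⟩
    rw [sect2Slot_succ_congr_of_agree_of_Omega_empty (FluctV N) _ _ _ hM s hΩ hE hR hB]
    exact hTcl s hΩ
  · by_cases h0 : slotsTOfRecord F N θ.ν θ.τ9 (EOfRecord₁₃Chi F N θ.toStage13Params χ) (wOfRecord₉ F N θ.toStage9Params) θ.ppSel p (gOfRecord₁₃Chi F N θ.toStage13Params χ p) (k + 1) s = 0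
    · -- 𝐓-absent expansion child: old `𝐁^{(k)}` and new `𝐑 ∕ 𝐁` zeroed; laws by bookkeeping, clause by the zero disjunct
      rw [spliceTermsB_of_absent t tnew s hΩ h0]
      refine ⟨lawsT_child_absent_of_newEClauses θ χ p hB₀ s (hs s.init).1 ?_, Or.inl h0⟩
      exact hEcl s _ (fun X z g => graftAbove_E_succ k _ _ X z g)
    · -- 𝐓-present expansion child: the supplier's obligations
      rw [spliceTermsB_of_present t tnew s hΩ h0, spliceConst_of_Omega_ne Ek EkN s hΩ]
      obtain ⟨hO1, hO2, hanE, hanR, hanB, hO3⟩ := hpres s hΩ h0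
      exact ⟨lawsT_child_graftAboveB_of_rows θ χ p s (hs s.init).1 hO1 hO2 hanE hanR hanB, hO3⟩

end TStep

/-! ## §3  Theorem 1 along the witness chain -/

section Chain

/-- **★★★ THE CHAIN WITNESS HAS THE §2 FORM OF `ρ_k` AT EVERY LEVEL `k ≤ K`** — Theorem 1 of [III] at a generic v1.7 parameter `θ` on the live-selector line, WITNESS-THREADED:
by induction on `k`, the base being def-T's level-0 witness (`baseWitness_form`), the step §2 (the splice of the chain's level-`k` witness with the supplier's response is a
𝐓-image witness) followed by §1 (the 𝐑-step keeps the witness).  HYPOTHESES, per level `k < K`, FOR THE CHAIN's level-`k` WITNESS ONLY, and each MAY ASSUME that witness's §2 form at `k` (the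
inductive hypothesis — print's §3 uses the inductive assumptions on the old terms): (OE) the four 𝐄-clauses for the
supplier's response; `PresentChildObligations` at the 𝐓-present expansion children ((O1′) the supplier's `𝐁^{(k)}`, (O2) Thm 2's clauses, (O3′) the 𝐓-image identity);
dag-n11-d's `NoExpansionClauseFor`.  Besides: core provisos (row `rstep`), the selector clause, admissibility, `0 ≤ κ, E₀, B₀`, `1 ≤ M`.  Every deliverable concerns objects the
suppliers built themselves — print's induction. [cite: Balaban1988Convergent, Thm 1 p.262, Theorem p.245, Thm 2 p.263, §3 p.279, (3.24)–(3.25) p.270; Balaban1989LargeFieldI, (0.2)–(0.4) p.176, p.177 (i)–(ii)] -/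
theorem formAtZS_chainWitness (h : θ.Provisos₁₃CoPHChi F N χ)
    (hsel : θ.ppSel = ppSelLiveOfRecord F N θ.ν θ.τ9 (EOfRecord₁₃Chi F N θ.toStage13Params χ) (wOfRecord₉ F N θ.toStage9Params))
    (hθ : θ.Admissible F N) (hκ : 0 ≤ θ.s2.lf.κ) (hE₀ : 0 ≤ θ.s2.lf.E₀) (hB₀ : 0 ≤ θ.s2.lf.B₀) (hM : 1 ≤ θ.τ9.M) (σ : Sect3Supplier θ χ p)
    (huN : ∀ k, k < p.K → HasSect2FormAtZS F N (FluctV N) p.K (settingOfRecord₁₃Chi F N θ.toStage13Params χ p) k (θ.rzAtChi χ p) (WtOfRecord₁₃HChi F N θ χ p) (UbgOfRecord₁₃CoPChi F N θ.toStage13Params χ p k)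
        (fun s u => Sect2.LawsRT (sect2TowerOfRecord F N (FluctV N) p.K (settingOfRecord₁₃Chi F N θ.toStage13Params χ p) (θ.rzAtChi χ p s) s u) (settingOfRecord₁₃Chi F N θ.toStage13Params χ p).lf k)
        (slotsOfRecord F N θ.ν θ.τ9 (EOfRecord₁₃Chi F N θ.toStage13Params χ) (wOfRecord₉ F N θ.toStage9Params) θ.ppSel p (gOfRecord₁₃Chi F N θ.toStage13Params χ p) k) (chainWitness θ χ p σ k).1 (chainWitness θ χ p σ k).2 →
      Sect2.UniversalE (σ k (chainWitness θ χ p σ k).1 (chainWitness θ χ p σ k).2).1)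
    (hOE : ∀ k, k < p.K → HasSect2FormAtZS F N (FluctV N) p.K (settingOfRecord₁₃Chi F N θ.toStage13Params χ p) k (θ.rzAtChi χ p) (WtOfRecord₁₃HChi F N θ χ p) (UbgOfRecord₁₃CoPChi F N θ.toStage13Params χ p k)
        (fun s u => Sect2.LawsRT (sect2TowerOfRecord F N (FluctV N) p.K (settingOfRecord₁₃Chi F N θ.toStage13Params χ p) (θ.rzAtChi χ p s) s u) (settingOfRecord₁₃Chi F N θ.toStage13Params χ p).lf k)
        (slotsOfRecord F N θ.ν θ.τ9 (EOfRecord₁₃Chi F N θ.toStage13Params χ) (wOfRecord₉ F N θ.toStage9Params) θ.ppSel p (gOfRecord₁₃Chi F N θ.toStage13Params χ p) k) (chainWitness θ χ p σ k).1 (chainWitness θ χ p σ k).2 →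
      ∀ s : SeqOfRecord F θ.ν θ.τ9.M (gOfRecord₁₃Chi F N θ.toStage13Params χ p) p.K (k + 1), NewEClausesAt θ χ p k ((σ k (chainWitness θ χ p σ k).1 (chainWitness θ χ p σ k).2).1 s) s)
    (hpres : ∀ k, k < p.K → HasSect2FormAtZS F N (FluctV N) p.K (settingOfRecord₁₃Chi F N θ.toStage13Params χ p) k (θ.rzAtChi χ p) (WtOfRecord₁₃HChi F N θ χ p) (UbgOfRecord₁₃CoPChi F N θ.toStage13Params χ p k)
        (fun s u => Sect2.LawsRT (sect2TowerOfRecord F N (FluctV N) p.K (settingOfRecord₁₃Chi F N θ.toStage13Params χ p) (θ.rzAtChi χ p s) s u) (settingOfRecord₁₃Chi F N θ.toStage13Params χ p).lf k)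
        (slotsOfRecord F N θ.ν θ.τ9 (EOfRecord₁₃Chi F N θ.toStage13Params χ) (wOfRecord₉ F N θ.toStage9Params) θ.ppSel p (gOfRecord₁₃Chi F N θ.toStage13Params χ p) k) (chainWitness θ χ p σ k).1 (chainWitness θ χ p σ k).2 →
      ∀ s : SeqOfRecord F θ.ν θ.τ9.M (gOfRecord₁₃Chi F N θ.toStage13Params χ p) p.K (k + 1), s.Ω (k + 1) ≠ ∅ → slotsTOfRecord F N θ.ν θ.τ9 (EOfRecord₁₃Chi F N θ.toStage13Params χ) (wOfRecord₉ F N θ.toStage9Params) θ.ppSel p (gOfRecord₁₃Chi F N θ.toStage13Params χ p) (k + 1) s ≠ 0 →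
      PresentChildObligations θ χ p k (chainWitness θ χ p σ k).1 (σ k (chainWitness θ χ p σ k).1 (chainWitness θ χ p σ k).2).1
        (σ k (chainWitness θ χ p σ k).1 (chainWitness θ χ p σ k).2).2 s)
    (hTcl : ∀ k, k < p.K → HasSect2FormAtZS F N (FluctV N) p.K (settingOfRecord₁₃Chi F N θ.toStage13Params χ p) k (θ.rzAtChi χ p) (WtOfRecord₁₃HChi F N θ χ p) (UbgOfRecord₁₃CoPChi F N θ.toStage13Params χ p k)
        (fun s u => Sect2.LawsRT (sect2TowerOfRecord F N (FluctV N) p.K (settingOfRecord₁₃Chi F N θ.toStage13Params χ p) (θ.rzAtChi χ p s) s u) (settingOfRecord₁₃Chi F N θ.toStage13Params χ p).lf k)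
        (slotsOfRecord F N θ.ν θ.τ9 (EOfRecord₁₃Chi F N θ.toStage13Params χ) (wOfRecord₉ F N θ.toStage9Params) θ.ppSel p (gOfRecord₁₃Chi F N θ.toStage13Params χ p) k) (chainWitness θ χ p σ k).1 (chainWitness θ χ p σ k).2 →
      NoExpansionClauseFor θ χ p k (chainWitness θ χ p σ k).1 (chainWitness θ χ p σ k).2) :
    ∀ k, k ≤ p.K → HasSect2FormAtZS F N (FluctV N) p.K (settingOfRecord₁₃Chi F N θ.toStage13Params χ p) k (θ.rzAtChi χ p) (WtOfRecord₁₃HChi F N θ χ p) (UbgOfRecord₁₃CoPChi F N θ.toStage13Params χ p k)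
      (fun s u => Sect2.LawsRT (sect2TowerOfRecord F N (FluctV N) p.K (settingOfRecord₁₃Chi F N θ.toStage13Params χ p) (θ.rzAtChi χ p s) s u) (settingOfRecord₁₃Chi F N θ.toStage13Params χ p).lf k)
      (slotsOfRecord F N θ.ν θ.τ9 (EOfRecord₁₃Chi F N θ.toStage13Params χ) (wOfRecord₉ F N θ.toStage9Params) θ.ppSel p (gOfRecord₁₃Chi F N θ.toStage13Params χ p) k) (chainWitness θ χ p σ k).1 (chainWitness θ χ p σ k).2 := by
  intro k
  induction k with
  | zero => exact fun _ => baseWitness_form θ χ p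
  | succ k ih =>
    intro hk
    have hk' : k < p.K := Nat.lt_of_succ_le hk
    exact formAtZS_succ_of_formT_of_liveSel_of_rstep θ χ p h hsel hθ hκ hE₀ hB₀ hk' _ _
      (formT_spliceTermsB_of_rows θ χ p hM hB₀ _ _ (ih hk'.le) _ _ (huN k hk' (ih hk'.le)) (hOE k hk' (ih hk'.le)) (hpres k hk' (ih hk'.le))
        (hTcl k hk' (ih hk'.le)))

end Chain

end Summit.QuantumFields.YangMills.Theorems.BalabanUVNodesN11Sect3SupplyChainChi

end

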